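import Literature.AlgebraicGeometry.Motives.AbelianVarietyRelFrobeniusFactorIso
import Literature.AlgebraicGeometry.Motives.AbelianVarietyVerschiebung
import Literature.AlgebraicGeometry.Motives.AbelianVarietyKerRankProofs
import Literature.AlgebraicGeometry.AbelianSchemes.DualIsogenyRelFrobenius
import Literature.AlgebraicGeometry.AbelianSchemes.DualIsogenyDegree
import HarnessLib

/-!
# The degree of the Verschiebung is `q^{dim A}`; the dual of the Frobenius is an isogeny of degree `q^{dim Â}`
# ([EdixhovenVanDerGeerMoonenAV] (5.20)–(5.21); [GortzWedhorn2023] Prop. 27.182; [MumfordAV1970] §15 Thm. 1)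

Layer `Literature/AlgebraicGeometry/Motives` (§1–§2, namespace `Literature.AlgebraicGeometry.Motives.AbelianVariety`) with a §3 in the
dot-notation namespace `Literature.AlgebraicGeometry.AbelianSchemes.AbelianSchemeOver.DualPair` of ★ `DualIsogenyRelFrobenius` (declared by absolute
names).  THEOREMS ONLY (no definition, no named fact, no instance, no notation, no `sorry`).  Cell `hodgecm-mathlib`, programme P6 (MOD), organ
**(V-deg)** — the degree bookkeeping that closes the A-lane (DF) package (★ p845237 FROB-PIC, ★ p845410 `F_{Â} ≫ (F_A)^∨ = [q]`, ★ p845506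
`isIsogeny_dualHom`): «`deg F = deg V = q^g`» ([EdixhovenVanDerGeerMoonenAV] Prop. (5.20): `F_{X/k}` and `V_{X/k}` are isogenies of degree `p^g`).

## Mathematics

Let `A` be an abelian variety of dimension `g` over a PERFECT field `k` of characteristic `p`, `q = p^n`, `F = F^{(n)}_{A/k} : A → A^{(q)}` the
relative Frobenius (★ `relFrobenius`, an isogeny of degree `q^g`: ★ `isIsogeny_relFrobenius`, ★ `kerRank_relFrobenius`).

* §1 **`kerRank_eq_of_relFrobenius_comp_eq_zsmul_id`**: ANY `V : A^{(q)} → A` with `F ≫ V = [q]_A` is an isogeny (★ `isIsogeny_of_relFrobenius_comp_eq`)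
  of degree `q^g` — degrees multiply along `F ≫ V = [q]` (★ `pow_mul_kerRank_of_relFrobenius_comp_eq`: `q^g · deg V = deg [q] = q^{2g}`, ★
  `kerRank_zsmul_id_holds`).
* §2 **`kerRank_verschiebung`**: the Verschiebung `V_{A/k}` of ★ `existsUnique_relFrobenius_comp_eq_pow_zsmul_id` (`F ≫ V = [q]`, unique) has degree
  `q^g`; `isIsogeny_verschiebung`.
* §3 (dual form) for a dual pair `D = (Â, 𝒫)` of `A` with the unit hypothesis: **`isIsogeny_dualHom_relFrobenius`** — `(F_A)^∨ : Â^{(q)} → Â` is an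
  isogeny (★ `isIsogeny_dualHom`) — and **`kerRank_dualHom_relFrobenius`** — `deg (F_A)^∨ = q^{dim Â}` (★ `F_{Â} ≫ (F_A)^∨ = [q]_{Â}` + §1 on `Â`).

HC_CM is proved only modulo the printed citations until rung 0 closes; this file changes no count.

## References
* [EdixhovenVanDerGeerMoonenAV] B. Edixhoven, G. van der Geer, B. Moonen, *Abelian Varieties* (book draft), Ch. 5 §2, Prop. (5.20), (5.21)
  (`V ∘ F = [p]`, `deg F = deg V = p^g`).
* [GortzWedhorn2023] U. Görtz, T. Wedhorn, *Algebraic Geometry II* (2023), Prop. 27.182 and Prop. 27.186 (p. 674).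
* [MumfordAV1970] D. Mumford, *Abelian Varieties* (1970), §15 Thm. 1 (p. 143).
-/

noncomputable section

universe u

open CategoryTheory CategoryTheory.Limits AlgebraicGeometry MonoidalCategory CartesianMonoidalCategory
open scoped MonObj

namespace Literature.AlgebraicGeometry.Motives

namespace AbelianVariety

variable {k : Type u} [Field k] (p : ℕ) [ExpChar k p] (n : ℕ) (A : AbelianVariety k)

/-! ## §1 Any `V` with `F ≫ V = [q]` is an isogeny of degree `q^{dim A}` -/

/-- **A factorisation `F ≫ V = [q]_A` of `[q]` (`q = p^n ≥ 1`... any `p^n`) through the relative Frobenius makes `V` an ISOGENY** (`[q]` is one, ★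
`isIsogeny_zsmul_id_holds`; ★ `isIsogeny_of_relFrobenius_comp_eq`). [cite: EdixhovenVanDerGeerMoonenAV, Ch. 5 §2 Prop. (5.20)] -/
theorem isIsogeny_of_relFrobenius_comp_eq_zsmul_id (V : A.frobeniusTwist p n ⟶ A)
    (hV : A.relFrobenius p n ≫ V = ((p ^ n : ℕ) : ℤ) • 𝟙 A) : IsIsogeny V :=
  haveI : Fact (1 ≤ p) := ⟨expChar_pos k p⟩
  isIsogeny_of_relFrobenius_comp_eq p n V
    (isIsogeny_zsmul_id_holds A _ (Int.natCast_ne_zero.mpr (pow_pos (expChar_pos k p) n).ne')) hV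

/-- **`deg V = q^{dim A}` for any `V : A^{(q)} → A` with `F ≫ V = [q]_A`** over a perfect field: `q^{dim A} · deg V = deg [q] = q^{2 dim A}` (★
`pow_mul_kerRank_of_relFrobenius_comp_eq`, ★ `kerRank_zsmul_id_holds`). [cite: EdixhovenVanDerGeerMoonenAV, Ch. 5 §2 Prop. (5.20)]
[cite: GortzWedhorn2023, Prop. 27.182 and Prop. 27.186 (p. 674)] -/
theorem kerRank_eq_of_relFrobenius_comp_eq_zsmul_id [PerfectField k] (V : A.frobeniusTwist p n ⟶ A)
    (hV : A.relFrobenius p n ≫ V = ((p ^ n : ℕ) : ℤ) • 𝟙 A) : Hom.kerRank V = p ^ (n * A.dim) := by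
  have hq : ((p ^ n : ℕ) : ℤ) ≠ 0 := Int.natCast_ne_zero.mpr (pow_pos (expChar_pos k p) n).ne'
  have h := pow_mul_kerRank_of_relFrobenius_comp_eq p n V (isIsogeny_zsmul_id_holds A _ hq) hV
  rw [kerRank_zsmul_id_holds A _ hq, Int.natAbs_natCast, ← pow_mul,
    show n * (2 * A.dim) = n * A.dim + n * A.dim by ring, pow_add] at h
  exact Nat.eq_of_mul_eq_mul_left (pow_pos (expChar_pos k p) _) h

/-! ## §2 The Verschiebung has degree `q^{dim A}` -/

/-- **The Verschiebung `V_{A/k}` (the unique `V` with `F ≫ V = [q]`, ★ `existsUnique_relFrobenius_comp_eq_pow_zsmul_id`) is an isogeny.**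
[cite: EdixhovenVanDerGeerMoonenAV, Ch. 5 §2 Prop. (5.20)] -/
theorem isIsogeny_verschiebung [PerfectField k] [Fact p.Prime] [CharP k p] :
    IsIsogeny (A.existsUnique_relFrobenius_comp_eq_pow_zsmul_id p n).exists.choose :=
  A.isIsogeny_of_relFrobenius_comp_eq_zsmul_id p n _ (A.existsUnique_relFrobenius_comp_eq_pow_zsmul_id p n).exists.choose_spec

/-- **`deg V_{A/k} = q^{dim A}`** for the Verschiebung of ★ `existsUnique_relFrobenius_comp_eq_pow_zsmul_id` (`q = p^n`, `k` perfect of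
characteristic `p`). [cite: EdixhovenVanDerGeerMoonenAV, Ch. 5 §2 Prop. (5.20)] [cite: GortzWedhorn2023, Prop. 27.182 and Prop. 27.186 (p. 674)] -/
theorem kerRank_verschiebung [PerfectField k] [Fact p.Prime] [CharP k p] :
    Hom.kerRank (A.existsUnique_relFrobenius_comp_eq_pow_zsmul_id p n).exists.choose = p ^ (n * A.dim) :=
  A.kerRank_eq_of_relFrobenius_comp_eq_zsmul_id p n _ (A.existsUnique_relFrobenius_comp_eq_pow_zsmul_id p n).exists.choose_spec

end AbelianVariety

end Literature.AlgebraicGeometry.Motives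

/-! ## §3 The dual of the Frobenius is an isogeny of degree `q^{dim Â}` -/

namespace Literature.AlgebraicGeometry.AbelianSchemes

namespace AbelianSchemeOver

namespace DualPair

open Literature.AlgebraicGeometry.Motives Literature.AlgebraicGeometry.Motives.AbelianVariety

-- `Scheme.Modules` / `SheafOfModules` are not reducible (as in ★ `DualIsogenyRelFrobenius`).
set_option backward.isDefEq.respectTransparency false

variable {k : Type u} [Field k] (p : ℕ) [ExpChar k p] (m : ℕ) (A : AbelianVariety k)
  (D : (AbelianScheme.ofAbelianVariety A).toOver.DualPair)
  (hD : Nonempty ((Scheme.Modules.pullback (unitHatSlice D)).obj D.P ≅ SheafOfModules.unit _))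

/-- **`F_{Â} ≫ (F_A)^∨ = [q]_{Â}` as morphisms of abelian varieties** (★ `relFrobenius_hat_comp_dualIsogenyOver_relFrobenius` read through ★
`dualHom`). [cite: MumfordAV1970, §15 Thm. 1 (p. 143)] -/
theorem relFrobenius_comp_dualHom_relFrobenius :
    (D.hat.toAffine.toAbelianVariety).relFrobenius p m ≫
        dualHom (A' := (AbelianScheme.ofAbelianVariety A).toOver) (B := (AbelianScheme.ofAbelianVariety (A.frobeniusTwist p m)).toOver)
          (A.relFrobenius p m).hom.hom.hom D (D.frobeniusTwist p m A) hD (D.nonempty_unitHatSlice_frobeniusTwist_iso p m A hD) =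
      ((p ^ m : ℕ) : ℤ) • 𝟙 _ := by
  refine AbelianVariety.hom_ext _ _ ?_
  rw [AbelianVariety.comp_hom, AbelianVariety.hom_zsmul_id, zpow_natCast]
  exact relFrobenius_hat_comp_dualIsogenyOver_relFrobenius p m A D hD

/-- **`(F_A)^∨ : Â^{(q)} → Â` is an ISOGENY** (★ `isIsogeny_dualHom`: `F_A` is one, ★ `isIsogeny_relFrobenius`).
[cite: MumfordAV1970, §15 Thm. 1 (p. 143)] [cite: EdixhovenVanDerGeerMoonenAV, Ch. 5 §2 (5.21)] -/
theorem isIsogeny_dualHom_relFrobenius :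
    IsIsogeny (dualHom (A' := (AbelianScheme.ofAbelianVariety A).toOver) (B := (AbelianScheme.ofAbelianVariety (A.frobeniusTwist p m)).toOver)
      (A.relFrobenius p m).hom.hom.hom D (D.frobeniusTwist p m A) hD (D.nonempty_unitHatSlice_frobeniusTwist_iso p m A hD)) := by
  refine isIsogeny_dualHom _ _ _ _ _ ?_
  have h : @homOfIsMonHom k _ (AbelianScheme.ofAbelianVariety A).toOver (AbelianScheme.ofAbelianVariety (A.frobeniusTwist p m)).toOver
      (A.relFrobenius p m).hom.hom.hom (A.relFrobenius p m).hom.hom.isMonHom_hom = A.relFrobenius p m :=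
    AbelianVariety.hom_ext _ _ rfl
  rw [h]
  exact A.isIsogeny_relFrobenius p m

/-- **`deg (F_A)^∨ = q^{dim Â}`** over a perfect field: `F_{Â} ≫ (F_A)^∨ = [q]_{Â}` and §1 on `Â`. [cite: MumfordAV1970, §15 Thm. 1 (p. 143)]
[cite: EdixhovenVanDerGeerMoonenAV, Ch. 5 §2 Prop. (5.20)] -/
theorem kerRank_dualHom_relFrobenius [PerfectField k] :
    Hom.kerRank (dualHom (A' := (AbelianScheme.ofAbelianVariety A).toOver) (B := (AbelianScheme.ofAbelianVariety (A.frobeniusTwist p m)).toOver)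
        (A.relFrobenius p m).hom.hom.hom D (D.frobeniusTwist p m A) hD (D.nonempty_unitHatSlice_frobeniusTwist_iso p m A hD)) =
      p ^ (m * D.hat.toAffine.toAbelianVariety.dim) :=
  (D.hat.toAffine.toAbelianVariety).kerRank_eq_of_relFrobenius_comp_eq_zsmul_id p m _ (relFrobenius_comp_dualHom_relFrobenius p m A D hD)

end DualPair

end AbelianSchemeOver

end Literature.AlgebraicGeometry.AbelianSchemes

end
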